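import Literature.RingTheory.KTheory.MilnorKWittRingNumberField
import Literature.RingTheory.KTheory.MilnorKWittRingFiniteFields
import Literature.RingTheory.KTheory.MilnorKBassTateLemma
import HarnessLib

/-!
# COROLLARY 5.8 and COROLLARY 5.2 (QUESTION 4.4) over number fields: `⋂ Iⁿ F(t) = 0` for every number field `F`, and
# `⋂ IⁿE = 0` for a henselian discretely valued `E` with number-field residue field
# (Milnor, *Algebraic K-theory and quadratic forms*, Invent. Math. 9 (1970), §4 Lemma 4.5, §5 Corollaries 5.2, 5.8)

Family `hodge`, lane `lit-hodgefound` (foundations library; seat `lit-hodgefound-p27`, generation 53, row g53-#5);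
topic `RingTheory/KTheory`.  Sequel of `MilnorKWittRingNumberField` (g53-#2: LEMMA 4.5 `iInf_pow_fundIdeal_eq_bot_numberField`,
`⋂ IⁿF = 0` for every number field), `MilnorKWittRingRatFuncAscent` (g42-#5: COROLLARY 5.8 for Question 4.4
`iInf_pow_fundIdeal_ratFunc_eq_bot` — from `⋂ IⁿF = 0` and `⋂ Iⁿκ_𝔭 = 0` at every closed point `𝔭` of the line),
`MilnorKWittRingResidueFieldAscent` (g42-#6: COROLLARY 5.2 for Question 4.4 `iInf_pow_fundIdeal_eq_bot_of_henselian`),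
`MilnorKWittRingResidue` (g41-#6: the functoriality `WittRing.map σ : W(F) →+* W(E)`) and `MilnorKBassTateLemma`
(`finiteDimensional_quotient`: `κ_𝔭 = F[t]/𝔭` is finite over `F`).  The residue fields `κ_𝔭` of `F(t)` are finite
extensions of `F`, hence number fields again, so LEMMA 4.5 feeds COROLLARY 5.8.  PROVED THEOREMS only; no definition,
no named fact, no instance, no notation, 0 `sorry`, net debt 0 (D-0026).

## The source, verbatim

J. Milnor, *Algebraic K-theory and quadratic forms*, Invent. Math. 9 (1970) 318–344 (held `paper:doi-10-1007-bf01425486`;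
bib key `Milnor1970`), §4 (p0015 L40–L41): «LEMMA 4.5. If F is a global field, or a direct limit of global fields, then
both questions have affirmative answers.»  §5 (p0017 L26–L27): «COROLLARY 5.2. If the questions 4.3 and 4.4 have
affirmative answers for the residue class field Ē, then they also have affirmative answers for E.»  (p0022 L11–L14):
«COROLLARY 5.8. If the questions 4.3 and 4.4 have affirmative answers for every finite extension F′ of a field F, then
they have affirmative answers for the field E = F(t) of rational functions.»  (p0018 L25–L26): «Note that L₀ is just the
image of the natural homomorphism WF → WE».

## What is formalised (Question 4.4 halves only — Question 4.3 for number fields needs Tate's computation of `kₙF`)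

* §1 (any fields) functoriality bookkeeping for the natural homomorphism `WittRing.map`: `map_map`, `map_id_apply`,
  `map_symm_map` / `map_injective_of_ringEquiv` (an isomorphism of fields induces an injection — indeed an isomorphism —
  of presented Witt rings), and the transport **`iInf_pow_fundIdeal_eq_bot_of_ringEquiv`** / `_iff_of_ringEquiv` of
  Question 4.4 along a field isomorphism.
* §2 **COROLLARY 5.8 (Question 4.4) for number fields: `iInf_pow_fundIdeal_ratFunc_numberField_eq_bot`** — `⋂ₙ Iⁿ F(t) = 0`
  for every number field `F` (the residue fields `κ_𝔭 ≅ F[t]/𝔭` are number fields: `numberField_quotient`), in particular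
  `iInf_pow_fundIdeal_ratFunc_rat_eq_bot` (`ℚ(t)`).
* §3 **COROLLARY 5.2 (Question 4.4) over number fields: `iInf_pow_fundIdeal_eq_bot_of_henselian_of_numberField`** —
  `⋂ₙ IⁿE = 0` for a henselian discretely valued field `E` whose residue field is a number field (e.g. `E = F((t))`), and the
  variant `…_of_ringEquiv_numberField` with the residue field only isomorphic to one.

## References

* [Milnor1970] J. Milnor, *Algebraic K-theory and quadratic forms*, Invent. Math. 9 (1970) 318–344 — §4 Lemma 4.5 (p0015
  L40–L41); §5 Corollary 5.2 (p0017 L26–L27), Corollary 5.8 (p0022 L11–L14), «the natural homomorphism WF → WE» (p0018 L25–L26).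

Provenance: lane `lit-hodgefound`, seat `lit-hodgefound-p27` gen 53 (agent `literature-prover-lit-hodgefound-p27-g53-0`),
row g53-#5.
-/

set_option autoImplicit false

noncomputable section

namespace Literature.RingTheory.KTheory

open Function Polynomial IsDedekindDomain

namespace WittRing

/-! ### §1 Functoriality of `W(F)` along field homomorphisms and isomorphisms -/

section Map

variable {F E L : Type*} [Field F] [Field E] [Field L]

/-- `map τ ∘ map σ = map (τ ∘ σ)` on `W(F)`. [cite: Milnor1970, §5 «the natural homomorphism WF → WE» (p0018 L25–L26)] -/
theorem map_map (σ : F →+* E) (τ : E →+* L) (w : WittRing F) : map τ (map σ w) = map (τ.comp σ) w := by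
  have h := addMonoidHom_ext F (f := (map τ).toAddMonoidHom.comp (map σ).toAddMonoidHom)
    (f' := (map (τ.comp σ)).toAddMonoidHom) fun a => by
      simp only [AddMonoidHom.comp_apply, RingHom.toAddMonoidHom_eq_coe, AddMonoidHom.coe_coe, map_gen]
      exact congrArg (gen L) (Units.ext rfl)
  exact DFunLike.congr_fun h w

/-- `map id = id` on `W(F)`. [cite: Milnor1970, §5 (p0018 L25–L26)] -/
theorem map_id_apply (w : WittRing F) : map (RingHom.id F) w = w := by
  have h := addMonoidHom_ext F (f := (map (RingHom.id F)).toAddMonoidHom) (f' := AddMonoidHom.id (WittRing F)) fun a => by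
    simp only [RingHom.toAddMonoidHom_eq_coe, AddMonoidHom.coe_coe, map_gen, AddMonoidHom.id_apply]
    exact congrArg (gen F) (Units.ext rfl)
  exact DFunLike.congr_fun h w

/-- A field isomorphism `e` has `map e⁻¹ ∘ map e = id`. [cite: Milnor1970, §5 (p0018 L25–L26)] -/
theorem map_symm_map (e : F ≃+* E) (w : WittRing F) : map e.symm.toRingHom (map e.toRingHom w) = w := by
  rw [map_map, RingEquiv.symm_toRingHom_comp_toRingHom, map_id_apply]

/-- **A field isomorphism induces an injection (indeed a bijection) of presented Witt rings.** [cite: Milnor1970, §5 (p0018 L25–L26)] -/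
theorem map_injective_of_ringEquiv (e : F ≃+* E) : Injective (map e.toRingHom) := fun x y h => by
  have h' := congrArg (map e.symm.toRingHom) h
  rwa [map_symm_map, map_symm_map] at h'

/-- A field isomorphism induces a surjection of presented Witt rings. [cite: Milnor1970, §5 (p0018 L25–L26)] -/
theorem map_surjective_of_ringEquiv (e : F ≃+* E) : Surjective (map e.toRingHom) := fun y =>
  ⟨map e.symm.toRingHom y, by
    have h := map_symm_map e.symm y
    rwa [RingEquiv.symm_symm] at h⟩

/-- **Question 4.4 transports along a field isomorphism**: if `⋂ IⁿE = 0` and `F ≅ E` then `⋂ IⁿF = 0`.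
[cite: Milnor1970, §4 Question 4.4 (p0015 L33–L35); §5 (p0018 L25–L26)] -/
theorem iInf_pow_fundIdeal_eq_bot_of_ringEquiv (e : F ≃+* E) (h : (⨅ n : ℕ, fundIdeal E ^ n) = ⊥) :
    (⨅ n : ℕ, fundIdeal F ^ n) = ⊥ := by
  refine eq_bot_iff.2 fun w hw => ?_
  rw [Submodule.mem_iInf] at hw
  rw [Submodule.mem_bot]
  apply map_injective_of_ringEquiv e
  rw [map_zero]
  have h' : map e.toRingHom w ∈ ⨅ n : ℕ, fundIdeal E ^ n :=
    (Submodule.mem_iInf _).2 fun n => map_mem_pow_fundIdeal _ (hw n)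
  rwa [h, Submodule.mem_bot] at h'

/-- Question 4.4 is invariant under field isomorphism. [cite: Milnor1970, §4 Question 4.4 (p0015 L33–L35); §5 (p0018 L25–L26)] -/
theorem iInf_pow_fundIdeal_eq_bot_iff_of_ringEquiv (e : F ≃+* E) :
    (⨅ n : ℕ, fundIdeal F ^ n) = ⊥ ↔ (⨅ n : ℕ, fundIdeal E ^ n) = ⊥ :=
  ⟨iInf_pow_fundIdeal_eq_bot_of_ringEquiv e.symm, iInf_pow_fundIdeal_eq_bot_of_ringEquiv e⟩

end Map

/-! ### §2 COROLLARY 5.8 (Question 4.4) for number fields: `⋂ Iⁿ F(t) = 0` -/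

section NumberField

open NumberField

/-- The residue field `F[t]/𝔭` at a closed point of the line over a number field is a number field (a finite extension
of `F`: «every finite extension F′ of a field F»). [cite: Milnor1970, §5 Corollary 5.8 (p0022 L11–L13)] -/
theorem numberField_quotient (F : Type) [Field F] [NumberField F] (v : HeightOneSpectrum F[X]) :
    haveI : v.asIdeal.IsMaximal := v.isPrime.isMaximal v.ne_bot
    letI : Field (F[X] ⧸ v.asIdeal) := Ideal.Quotient.field v.asIdeal
    NumberField (F[X] ⧸ v.asIdeal) := by
  haveI : v.asIdeal.IsMaximal := v.isPrime.isMaximal v.ne_bot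
  letI : Field (F[X] ⧸ v.asIdeal) := Ideal.Quotient.field v.asIdeal
  haveI : Module.Finite F (F[X] ⧸ v.asIdeal) := MilnorK.finiteDimensional_quotient v
  exact NumberField.of_module_finite F (F[X] ⧸ v.asIdeal)

/-- **COROLLARY 5.8 (Question 4.4) for a number field: `⋂ₙ Iⁿ F(t) = 0`** — LEMMA 4.5 for `F` and for the residue fields
`κ_𝔭 ≅ F[t]/𝔭` (number fields), then Milnor's Corollary 5.8 through THEOREM 5.3. [cite: Milnor1970, §5 Corollary 5.8 (p0022 L11–L14); §4 Lemma 4.5 (p0015 L40–L41)] -/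
theorem iInf_pow_fundIdeal_ratFunc_numberField_eq_bot (F : Type) [Field F] [NumberField F] :
    (⨅ n : ℕ, fundIdeal (RatFunc F) ^ n) = ⊥ := by
  refine iInf_pow_fundIdeal_ratFunc_eq_bot F two_ne_zero (iInf_pow_fundIdeal_eq_bot_numberField F) fun v => ?_
  haveI : v.asIdeal.IsMaximal := v.isPrime.isMaximal v.ne_bot
  letI : Field (F[X] ⧸ v.asIdeal) := Ideal.Quotient.field v.asIdeal
  haveI : NumberField (F[X] ⧸ v.asIdeal) := numberField_quotient F v
  exact iInf_pow_fundIdeal_eq_bot_of_ringEquiv (quotientEquivResidueFieldAt F[X] (RatFunc F) v).symm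
    (iInf_pow_fundIdeal_eq_bot_numberField (F[X] ⧸ v.asIdeal))

/-- `⋂ₙ Iⁿ ℚ(t) = 0`. [cite: Milnor1970, §5 Corollary 5.8 (p0022 L11–L14); §4 Lemma 4.5 (p0015 L40–L41)] -/
theorem iInf_pow_fundIdeal_ratFunc_rat_eq_bot : (⨅ n : ℕ, fundIdeal (RatFunc ℚ) ^ n) = ⊥ :=
  iInf_pow_fundIdeal_ratFunc_numberField_eq_bot ℚ

end NumberField

/-! ### §3 COROLLARY 5.2 (Question 4.4) for a henselian `E` with number-field residue field -/

section Henselian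

open NumberField

variable {E : Type} [Field E] (v : Valuation E (WithZero (Multiplicative ℤ))) {π : Eˣ} (hπ : addVal v π = 1)

include hπ

/-- **COROLLARY 5.2 (Question 4.4): a henselian discretely valued field whose residue field is a number field has
`⋂ₙ IⁿE = 0`** (e.g. `E = F((t))`, `F` a number field; `char Ē = 0 ≠ 2`). [cite: Milnor1970, §5 Corollary 5.2 (p0017 L26–L27); §4 Lemma 4.5 (p0015 L40–L41)] -/
theorem iInf_pow_fundIdeal_eq_bot_of_henselian_of_numberField [HenselianLocalRing v.valuationSubring]
    [NumberField (ValResidueField v)] : (⨅ n : ℕ, fundIdeal E ^ n) = ⊥ :=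
  iInf_pow_fundIdeal_eq_bot_of_henselian v hπ two_ne_zero (iInf_pow_fundIdeal_eq_bot_numberField (ValResidueField v))

/-- The same with the residue field only ISOMORPHIC to a number field `L`. [cite: Milnor1970, §5 Corollary 5.2 (p0017 L26–L27); §4 Lemma 4.5 (p0015 L40–L41)] -/
theorem iInf_pow_fundIdeal_eq_bot_of_henselian_of_ringEquiv_numberField [HenselianLocalRing v.valuationSubring]
    {L : Type} [Field L] [NumberField L] (e : ValResidueField v ≃+* L) : (⨅ n : ℕ, fundIdeal E ^ n) = ⊥ := by
  have h2 : (2 : ValResidueField v) ≠ 0 := by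
    intro h
    have h' : (2 : L) = 0 := by rw [← map_ofNat e 2, h, map_zero]
    exact two_ne_zero h'
  exact iInf_pow_fundIdeal_eq_bot_of_henselian v hπ h2
    (iInf_pow_fundIdeal_eq_bot_of_ringEquiv e (iInf_pow_fundIdeal_eq_bot_numberField L))

end Henselian

end WittRing

end Literature.RingTheory.KTheory

end
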